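import Mathlib
import Literature.NumberTheory.Irrationality.DirichletLValues.ChowlaMilnorLevelRaisingProofs
import Literature.NumberTheory.Irrationality.DirichletLValues.ChowlaMilnorSmallModuliProofs
import Literature.NumberTheory.Irrationality.LaiZhou2022.OddZetaAndBetaRecords
import HarnessLib

/-!
# Level raising for the TYPED Chowla–Milnor spaces: Lai–Li's Corollary 4.2 for `V_k(q)`, `V_k^+(q)`, `V_k^−(q)`, and
# `V_k^−(4) = ℚζ(k)` (odd `k`) `= ℚβ(k)` (even `k`)

Topic `Literature/NumberTheory/Irrationality/DirichletLValues`. Proofs-only leaf (theorems only, no definition, no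
named fact, no `sorry`; cell pub-zeta5, P1 g54), sequel of `ChowlaMilnorLevelRaisingProofs.lean` (the sign-generic
full-range spans `F_s(q)`): identification with the typed `oddChowlaMilnorSpace k q` (`ChowlaMilnor.lean`, Lai–Li
Def. 1.3) and with the written-out `V_k(q)` / `V_k^+(q)` of the companion files, and the printed consequences.

## Source (read on the page)

L. Lai, J. Li, arXiv:2505.12687v2 [LaiLi2025]: p. 3 «for any integers `k ≥ 2` and `q ≥ 3` we have
`V_k(q) = V_k^+(q) + V_k^−(q)` … For example, if `q = 4`, then `V⁻_k(4) = ζ(k)ℚ` if `k ≥ 3` is odd, `β(k)ℚ` if `k ≥ 2` is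
even, where `β(·)` denotes the Dirichlet beta function»; p. 6 «it is easy to see that
`V_k^−(q) = Span_ℚ {ζ⁻(k,a/q) | 1 ≤ a < q, (a,q) = 1}`, `V_k^+(q) = Span_ℚ {ζ⁺(k,a/q) | 1 ≤ a < q, (a,q) = 1}` (`k ≥ 2`,
`q ≥ 3`)»; p. 7 «**Corollary 4.2.** (1) For any divisor `q′ ≥ 2` of `q`, `V⁻_k(q′) ⊂ V⁻_k(q)`, `V⁺_k(q′) ⊂ V⁺_k(q)`,
`V_k(q′) ⊂ V_k(q)`. (2) For any integer `a ∈ {1,…,q−1}` (not necessarily coprime to `q`), `ζ⁻(k,a/q) ∈ V_k⁻(q)`,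
`ζ⁺(k,a/q) ∈ V_k⁺(q)`, `ζ(k,a/q) ∈ V_k(q)`. (3) `Span_ℚ({1, δ_kζ(k)} ∪ {ζ⁻(k,a/q) | 1 ≤ a < q/2}) = ℚ + V_k⁻(q)`» with
«If `k` is odd, … `ζ(k) = … ∈ V_k⁻(q)`».

## What is proved (`k ≥ 2`; `q′ ≥ 3` where the typed half-system spaces are concerned)

* `span_hurwitzSign_full_eq_half`, `oddChowlaMilnorSpace_eq_span_full`,
  `span_hurwitzEven_eq_span_full` — the full-range descriptions (p. 6);
* **`span_hurwitzValue_mono`**, **`oddChowlaMilnorSpace_mono`**, **`span_hurwitzEven_mono`** — COROLLARY 4.2 (1);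
* **`hurwitzValue_mem_span_of_lt`**, **`hurwitzOdd_mem_oddChowlaMilnorSpace_of_lt`**, **`hurwitzEven_mem_span_of_lt`** —
  COROLLARY 4.2 (2);
* **`zetaValue_mem_oddChowlaMilnorSpace`** (odd `k`: `ζ(k) ∈ V_k⁻(q)`), `zetaValue_mem_span_hurwitzEven` (even `k`:
  `ζ(k) ∈ V_k⁺(q)`), `span_insert_eq_sup_oddChowlaMilnorSpace` — COROLLARY 4.2 (3);
* `hurwitzValue_quarter_sub_eq_betaValue` (`ζ(k,1/4) − ζ(k,3/4) = 4^k β(k)`), **`oddChowlaMilnorSpace_four_eq_of_odd`**,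
  **`oddChowlaMilnorSpace_four_eq_of_even`** — the example `V⁻_k(4) = ℚζ(k)` / `ℚβ(k)` (`β` = the tree's
  `LaiZhou2022.betaValue`).

HONEST FRAMING: printed unconditional statements made kernel theorems; Lai–Li's Theorem 1.5 is NOT discharged; the
arithmetic nature of `ζ(k)`, `β(k)` is untouched; nothing here concerns `ζ(5)`.
-/

noncomputable section

open Finset

open scoped Nat

namespace Literature.NumberTheory.Irrationality.DirichletLValues

open Literature.NumberTheory.Transcendental Literature.NumberTheory.Irrationality.LaiZhou2022

/-! ### Full-range descriptions -/

/-- `F_0(q) = V_k(q)`: with the sign `s = 0` the generic span is the Chowla–Milnor space itself. [folklore] -/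
private theorem span_hurwitzSign_zero_eq (k q : ℕ) :
    Submodule.span ℚ {y : ℝ | ∃ a : ℕ, 1 ≤ a ∧ a < q ∧ Nat.Coprime a q ∧
        y = hurwitzValue k ((a : ℝ) / q) + (0 : ℝ) * hurwitzValue k (1 - (a : ℝ) / q)} =
      Submodule.span ℚ {y : ℝ | ∃ a : ℕ, 1 ≤ a ∧ a < q ∧ Nat.Coprime a q ∧ y = hurwitzValue k ((a : ℝ) / q)} := by
  simp only [zero_mul, add_zero]

/-- **«It is easy to see»** (p. 6): for `q ≥ 3` and a sign with `s·s = 1`, the full-range span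
`Span {ζ(k,a/q) + sζ(k,1−a/q) : 1 ≤ a < q, (a,q)=1}` equals the half-range span over `1 ≤ a < q/2`, since
`ζ(k,(q−a)/q) + sζ(k,a/q) = s·(ζ(k,a/q) + sζ(k,1−a/q))`. [cite: LaiLi2025, §4 p. 6 (full-range description of V_k^±(q))] -/
theorem span_hurwitzSign_full_eq_half {k q : ℕ} (hq : 3 ≤ q) {s : ℝ} (hs : s * s = 1) (hsQ : ∃ r : ℚ, (r : ℝ) = s) :
    Submodule.span ℚ {y : ℝ | ∃ a : ℕ, 1 ≤ a ∧ a < q ∧ Nat.Coprime a q ∧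
        y = hurwitzValue k ((a : ℝ) / q) + s * hurwitzValue k (1 - (a : ℝ) / q)} =
      Submodule.span ℚ {y : ℝ | ∃ a : ℕ, 1 ≤ a ∧ 2 * a < q ∧ Nat.Coprime a q ∧
        y = hurwitzValue k ((a : ℝ) / q) + s * hurwitzValue k (1 - (a : ℝ) / q)} := by
  obtain ⟨r, rfl⟩ := hsQ
  have hq0 : (q : ℝ) ≠ 0 := by exact_mod_cast (show q ≠ 0 by omega)
  refine le_antisymm (Submodule.span_le.2 ?_) (Submodule.span_mono ?_)
  · rintro y ⟨a, ha1, haq, hcop, rfl⟩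
    have h2a : 2 * a ≠ q := by
      intro h2
      have ha : a ∣ q := ⟨2, by omega⟩
      have := Nat.Coprime.eq_one_of_dvd hcop ha
      omega
    rcases lt_or_gt_of_ne h2a with hlt | hgt
    · exact Submodule.subset_span ⟨a, ha1, hlt, hcop, rfl⟩
    · set b : ℕ := q - a with hb
      have hb1 : 1 ≤ b := by omega
      have h2b : 2 * b < q := by omega
      have hcopb : Nat.Coprime b q := (Nat.coprime_self_sub_left haq.le).2 hcop
      have eb : (b : ℝ) / q = 1 - (a : ℝ) / q := by rw [hb, Nat.cast_sub haq.le]; field_simp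
      have eb' : (1 : ℝ) - (b : ℝ) / q = (a : ℝ) / q := by rw [eb]; ring
      have e : hurwitzValue k ((a : ℝ) / q) + (r : ℝ) * hurwitzValue k (1 - (a : ℝ) / q) =
          r • (hurwitzValue k ((b : ℝ) / q) + (r : ℝ) * hurwitzValue k (1 - (b : ℝ) / q)) := by
        rw [Rat.smul_def, eb', eb]
        linear_combination (-(hurwitzValue k ((a : ℝ) / q))) * hs
      rw [e]
      exact Submodule.smul_mem _ _ (Submodule.subset_span ⟨b, hb1, h2b, hcopb, rfl⟩)
  · rintro y ⟨a, ha1, h2a, hcop, rfl⟩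
    exact ⟨a, ha1, by omega, hcop, rfl⟩

/-- **The typed odd space in full-range form** (p. 6): for `q ≥ 3`,
`V_k⁻(q) = Span_ℚ {ζ(k,a/q) + (−(−1)^k)ζ(k,1−a/q) : 1 ≤ a < q, (a,q)=1}`. [cite: LaiLi2025, §4 p. 6] -/
theorem oddChowlaMilnorSpace_eq_span_full {k q : ℕ} (hq : 3 ≤ q) :
    oddChowlaMilnorSpace k q =
      Submodule.span ℚ {y : ℝ | ∃ a : ℕ, 1 ≤ a ∧ a < q ∧ Nat.Coprime a q ∧
        y = hurwitzValue k ((a : ℝ) / q) + (-(-1 : ℝ) ^ k) * hurwitzValue k (1 - (a : ℝ) / q)} := by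
  rw [span_hurwitzSign_full_eq_half hq (by rw [neg_mul_neg, ← pow_add, ← two_mul, pow_mul]; norm_num)
    ⟨-(-1) ^ k, by push_cast; ring⟩]
  unfold oddChowlaMilnorSpace hurwitzOdd
  congr 1
  ext y
  simp only [Set.mem_setOf_eq, neg_mul, sub_eq_add_neg]

/-- **The even space in full-range form** (p. 6): for `q ≥ 3`,
`V_k⁺(q) = Span_ℚ {ζ(k,a/q) + (−1)^kζ(k,1−a/q) : 1 ≤ a < q, (a,q)=1}`. [cite: LaiLi2025, §4 p. 6] -/
theorem span_hurwitzEven_eq_span_full {k q : ℕ} (hq : 3 ≤ q) :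
    Submodule.span ℚ {y : ℝ | ∃ a : ℕ, 1 ≤ a ∧ 2 * a < q ∧ Nat.Coprime a q ∧
        y = hurwitzValue k ((a : ℝ) / q) + (-1 : ℝ) ^ k * hurwitzValue k (1 - (a : ℝ) / q)} =
      Submodule.span ℚ {y : ℝ | ∃ a : ℕ, 1 ≤ a ∧ a < q ∧ Nat.Coprime a q ∧
        y = hurwitzValue k ((a : ℝ) / q) + (-1 : ℝ) ^ k * hurwitzValue k (1 - (a : ℝ) / q)} :=
  (span_hurwitzSign_full_eq_half hq (by rw [← pow_add, ← two_mul, pow_mul]; norm_num)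
    ⟨(-1) ^ k, by push_cast; ring⟩).symm

/-! ### Corollary 4.2 (1) for the typed spaces -/

/-- **Corollary 4.2 (1), `V_k(q′) ⊂ V_k(q)`** for `2 ≤ q′ ∣ q`, `k ≥ 2`. [cite: LaiLi2025, Corollary 4.2 (1) (p. 7)] -/
theorem span_hurwitzValue_mono {k q' q : ℕ} (hk : 2 ≤ k) (hq' : 2 ≤ q') (hq : q ≠ 0) (hdvd : q' ∣ q) :
    Submodule.span ℚ {y : ℝ | ∃ a : ℕ, 1 ≤ a ∧ a < q' ∧ Nat.Coprime a q' ∧ y = hurwitzValue k ((a : ℝ) / q')} ≤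
      Submodule.span ℚ {y : ℝ | ∃ a : ℕ, 1 ≤ a ∧ a < q ∧ Nat.Coprime a q ∧ y = hurwitzValue k ((a : ℝ) / q)} := by
  rw [← span_hurwitzSign_zero_eq k q', ← span_hurwitzSign_zero_eq k q]
  exact span_hurwitzSign_le_of_dvd hk hq' hq hdvd 0

/-- **Corollary 4.2 (1), `V_k⁻(q′) ⊂ V_k⁻(q)`** for `3 ≤ q′ ∣ q`, `k ≥ 2` (the typed `oddChowlaMilnorSpace`).
[cite: LaiLi2025, Corollary 4.2 (1) (p. 7)] -/
theorem oddChowlaMilnorSpace_mono {k q' q : ℕ} (hk : 2 ≤ k) (hq' : 3 ≤ q') (hq : q ≠ 0) (hdvd : q' ∣ q) :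
    oddChowlaMilnorSpace k q' ≤ oddChowlaMilnorSpace k q := by
  have hq3 : 3 ≤ q := le_trans hq' (Nat.le_of_dvd (Nat.pos_of_ne_zero hq) hdvd)
  rw [oddChowlaMilnorSpace_eq_span_full hq', oddChowlaMilnorSpace_eq_span_full hq3]
  exact span_hurwitzSign_le_of_dvd hk (by omega) hq hdvd _

/-- **Corollary 4.2 (1), `V_k⁺(q′) ⊂ V_k⁺(q)`** for `3 ≤ q′ ∣ q`, `k ≥ 2`. [cite: LaiLi2025, Corollary 4.2 (1) (p. 7)] -/
theorem span_hurwitzEven_mono {k q' q : ℕ} (hk : 2 ≤ k) (hq' : 3 ≤ q') (hq : q ≠ 0) (hdvd : q' ∣ q) :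
    Submodule.span ℚ {y : ℝ | ∃ a : ℕ, 1 ≤ a ∧ 2 * a < q' ∧ Nat.Coprime a q' ∧
        y = hurwitzValue k ((a : ℝ) / q') + (-1 : ℝ) ^ k * hurwitzValue k (1 - (a : ℝ) / q')} ≤
      Submodule.span ℚ {y : ℝ | ∃ a : ℕ, 1 ≤ a ∧ 2 * a < q ∧ Nat.Coprime a q ∧
        y = hurwitzValue k ((a : ℝ) / q) + (-1 : ℝ) ^ k * hurwitzValue k (1 - (a : ℝ) / q)} := by
  have hq3 : 3 ≤ q := le_trans hq' (Nat.le_of_dvd (Nat.pos_of_ne_zero hq) hdvd)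
  rw [span_hurwitzEven_eq_span_full hq', span_hurwitzEven_eq_span_full hq3]
  exact span_hurwitzSign_le_of_dvd hk (by omega) hq hdvd _

/-! ### Corollary 4.2 (2) for the typed spaces -/

/-- **Corollary 4.2 (2), `ζ(k,a/q) ∈ V_k(q)` for every `1 ≤ a < q`** (`k ≥ 2`), coprime or not.
[cite: LaiLi2025, Corollary 4.2 (2) (p. 7)] -/
theorem hurwitzValue_mem_span_of_lt {k q a : ℕ} (hk : 2 ≤ k) (ha1 : 1 ≤ a) (haq : a < q) :
    hurwitzValue k ((a : ℝ) / q) ∈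
      Submodule.span ℚ {y : ℝ | ∃ a : ℕ, 1 ≤ a ∧ a < q ∧ Nat.Coprime a q ∧ y = hurwitzValue k ((a : ℝ) / q)} := by
  rw [← span_hurwitzSign_zero_eq k q]
  simpa using hurwitzSign_mem_span_of_lt hk ha1 haq 0

/-- **Corollary 4.2 (2), `ζ⁻(k,a/q) ∈ V_k⁻(q)` for every `1 ≤ a < q`** (`k ≥ 2`, `q ≥ 3`).
[cite: LaiLi2025, Corollary 4.2 (2) (p. 7)] -/
theorem hurwitzOdd_mem_oddChowlaMilnorSpace_of_lt {k q a : ℕ} (hk : 2 ≤ k) (hq : 3 ≤ q) (ha1 : 1 ≤ a) (haq : a < q) :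
    hurwitzOdd k ((a : ℝ) / q) ∈ oddChowlaMilnorSpace k q := by
  rw [oddChowlaMilnorSpace_eq_span_full hq]
  have h := hurwitzSign_mem_span_of_lt hk ha1 haq (-(-1 : ℝ) ^ k)
  have e : hurwitzOdd k ((a : ℝ) / q) =
      hurwitzValue k ((a : ℝ) / q) + (-(-1 : ℝ) ^ k) * hurwitzValue k (1 - (a : ℝ) / q) := by
    rw [hurwitzOdd]; ring
  rw [e]; exact h

/-- **Corollary 4.2 (2), `ζ⁺(k,a/q) ∈ V_k⁺(q)` for every `1 ≤ a < q`** (`k ≥ 2`, `q ≥ 3`).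
[cite: LaiLi2025, Corollary 4.2 (2) (p. 7)] -/
theorem hurwitzEven_mem_span_of_lt {k q a : ℕ} (hk : 2 ≤ k) (hq : 3 ≤ q) (ha1 : 1 ≤ a) (haq : a < q) :
    hurwitzValue k ((a : ℝ) / q) + (-1 : ℝ) ^ k * hurwitzValue k (1 - (a : ℝ) / q) ∈
      Submodule.span ℚ {y : ℝ | ∃ a : ℕ, 1 ≤ a ∧ 2 * a < q ∧ Nat.Coprime a q ∧
        y = hurwitzValue k ((a : ℝ) / q) + (-1 : ℝ) ^ k * hurwitzValue k (1 - (a : ℝ) / q)} := by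
  rw [span_hurwitzEven_eq_span_full hq]
  exact hurwitzSign_mem_span_of_lt hk ha1 haq _

/-! ### Corollary 4.2 (3): `ζ(k)` and the constant -/

/-- **`ζ(k) ∈ V_k⁻(q)` for odd `k ≥ 3`, `q ≥ 3`** («If `k` is odd, then … `ζ(k) = (1/(2(q^k−1))) Σ_a ζ⁻_k(a/q) ∈ V_k⁻(q)`»,
Cor. 4.2 (3)); here from the coprime sum `J_k(q)ζ(k) ∈ V_k⁻(q)` (`ChowlaMilnorOddEvenSplitProofs`).
[cite: LaiLi2025, Corollary 4.2 (3) and its proof (p. 7)] -/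
theorem zetaValue_mem_oddChowlaMilnorSpace {k q : ℕ} (hk : Odd k) (hk2 : 2 ≤ k) (hq : 3 ≤ q) :
    zetaValue k ∈ oddChowlaMilnorSpace k q := by
  set J : ℤ := ∑ d ∈ q.divisors, (ArithmeticFunction.moebius d : ℤ) * ((q / d : ℕ) : ℤ) ^ k with hJ
  have hJpos : 0 < J := jordan_pos (by omega) hk2
  have hmem := sum_coprime_hurwitzValue_mem_oddChowlaMilnorSpace hk hq
  rw [sum_coprime_hurwitzValue_eq (by omega) hk2, ← hJ] at hmem
  have e : zetaValue k = ((J : ℚ)⁻¹ : ℚ) • ((J : ℝ) * zetaValue k) := by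
    have hJ0 : (J : ℝ) ≠ 0 := by exact_mod_cast hJpos.ne'
    rw [Rat.smul_def]; push_cast; field_simp
  rw [e]
  exact Submodule.smul_mem _ _ hmem

/-- **`ζ(k) ∈ V_k⁺(q)` for even `k ≥ 2`, `q ≥ 3`**: the coprime sum `Σ_{(a,q)=1} ζ(k,a/q) = J_k(q)ζ(k)` («a rational multiple
of `ζ(k)`», GMR p. 1336) pairs into `Σ_{a<q/2} ζ⁺(k,a/q)`. [cite: GunRammurtyRath2011, proof of Proposition 2 (p. 1336)]
[cite: LaiLi2025, (1.1) (p. 3)] -/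
theorem zetaValue_mem_span_hurwitzEven {k q : ℕ} (hk : Even k) (hk2 : 2 ≤ k) (hq : 3 ≤ q) :
    zetaValue k ∈ Submodule.span ℚ {y : ℝ | ∃ a : ℕ, 1 ≤ a ∧ 2 * a < q ∧ Nat.Coprime a q ∧
        y = hurwitzValue k ((a : ℝ) / q) + (-1 : ℝ) ^ k * hurwitzValue k (1 - (a : ℝ) / q)} := by
  set J : ℤ := ∑ d ∈ q.divisors, (ArithmeticFunction.moebius d : ℤ) * ((q / d : ℕ) : ℤ) ^ k with hJ
  have hJpos : 0 < J := jordan_pos (by omega) hk2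
  have hmem : ∑ a ∈ (Finset.Ioc 0 q).filter (fun a => a.Coprime q), hurwitzValue k ((a : ℝ) / q) ∈
      Submodule.span ℚ {y : ℝ | ∃ a : ℕ, 1 ≤ a ∧ 2 * a < q ∧ Nat.Coprime a q ∧
        y = hurwitzValue k ((a : ℝ) / q) + (-1 : ℝ) ^ k * hurwitzValue k (1 - (a : ℝ) / q)} := by
    rw [sum_coprime_eq_sum_halfSystem hq (fun a : ℕ => hurwitzValue k ((a : ℝ) / q))]
    refine Submodule.sum_mem _ fun a ha => ?_
    simp only [mem_filter, mem_range] at ha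
    obtain ⟨haq, h2a, hcop⟩ := ha
    have ha1 : 1 ≤ a := by
      rcases Nat.eq_zero_or_pos a with rfl | hpos
      · rw [Nat.coprime_zero_left] at hcop; omega
      · exact hpos
    have hq0 : (q : ℝ) ≠ 0 := by exact_mod_cast (show q ≠ 0 by omega)
    have e : hurwitzValue k ((a : ℝ) / q) + hurwitzValue k (((q - a : ℕ) : ℝ) / q) =
        hurwitzValue k ((a : ℝ) / q) + (-1 : ℝ) ^ k * hurwitzValue k (1 - (a : ℝ) / q) := by
      rw [Even.neg_one_pow hk, one_mul, Nat.cast_sub haq.le]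
      have e1 : ((q : ℝ) - a) / q = 1 - (a : ℝ) / q := by field_simp
      rw [e1]
    rw [e]
    exact Submodule.subset_span ⟨a, ha1, h2a, hcop, rfl⟩
  rw [sum_coprime_hurwitzValue_eq (by omega) hk2, ← hJ] at hmem
  have e : zetaValue k = ((J : ℚ)⁻¹ : ℚ) • ((J : ℝ) * zetaValue k) := by
    have hJ0 : (J : ℝ) ≠ 0 := by exact_mod_cast hJpos.ne'
    rw [Rat.smul_def]; push_cast; field_simp
  rw [e]
  exact Submodule.smul_mem _ _ hmem

/-- **Corollary 4.2 (3)** for odd `k ≥ 3`, `q ≥ 3`: `Span_ℚ({1, ζ(k)} ∪ {ζ⁻(k,a/q) : 1 ≤ a < q/2}) = ℚ·1 + V_k⁻(q)` (all `a`, not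
only the coprime ones). [cite: LaiLi2025, Corollary 4.2 (3) and its proof (p. 7)] -/
theorem span_insert_eq_sup_oddChowlaMilnorSpace {k q : ℕ} (hk : Odd k) (hk2 : 2 ≤ k) (hq : 3 ≤ q) :
    Submodule.span ℚ (insert (1 : ℝ) (insert (zetaValue k)
        {y : ℝ | ∃ a : ℕ, 1 ≤ a ∧ 2 * a < q ∧ y = hurwitzOdd k ((a : ℝ) / q)})) =
      Submodule.span ℚ {(1 : ℝ)} ⊔ oddChowlaMilnorSpace k q := by
  refine le_antisymm ?_ ?_
  · refine Submodule.span_le.2 ?_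
    intro y hy
    rcases hy with rfl | rfl | ⟨a, ha1, h2a, rfl⟩
    · exact Submodule.mem_sup_left (Submodule.subset_span rfl)
    · exact Submodule.mem_sup_right (zetaValue_mem_oddChowlaMilnorSpace hk hk2 hq)
    · exact Submodule.mem_sup_right (hurwitzOdd_mem_oddChowlaMilnorSpace_of_lt hk2 hq ha1 (by omega))
  · refine sup_le (Submodule.span_mono (Set.singleton_subset_iff.2 (Set.mem_insert _ _))) ?_
    refine Submodule.span_le.2 ?_
    rintro y ⟨a, ha1, h2a, -, rfl⟩
    exact Submodule.subset_span (Set.mem_insert_of_mem _ (Set.mem_insert_of_mem _ ⟨a, ha1, h2a, rfl⟩))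

/-! ### The example `q = 4` -/

/-- **`ζ(k, 1/4) − ζ(k, 3/4) = 4^k β(k)`** (`k ≥ 2`), `β(k) = Σ_n (−1)^n/(2n+1)^k` the tree's `betaValue`: the even- and
odd-indexed halves of the beta series are `4^{−k}ζ(k,1/4)` and `−4^{−k}ζ(k,3/4)`.
[cite: LaiLi2025, p. 3 («V⁻_k(4) = β(k)ℚ … where β(·) denotes the Dirichlet beta function»)] -/
theorem hurwitzValue_quarter_sub_eq_betaValue {k : ℕ} (hk : 2 ≤ k) :
    hurwitzValue k (1 / 4) - hurwitzValue k (3 / 4) = 4 ^ k * betaValue k := by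
  have h1 := hasSum_progression_hurwitzValue (u := 1) (v := 4) (s := k) le_rfl (by norm_num) hk
  have h3 := hasSum_progression_hurwitzValue (u := 3) (v := 4) (s := k) (by norm_num) (by norm_num) hk
  push_cast at h1 h3
  have he : HasSum (fun n : ℕ => (-1 : ℝ) ^ (2 * n) / ((2 * ((2 * n : ℕ) : ℝ) + 1)) ^ k)
      (1 / (4 : ℝ) ^ k * hurwitzValue k (1 / 4)) := by
    refine h1.congr_fun fun n => ?_
    rw [pow_mul, neg_one_sq, one_pow]; push_cast; ring
  have ho : HasSum (fun n : ℕ => (-1 : ℝ) ^ (2 * n + 1) / ((2 * ((2 * n + 1 : ℕ) : ℝ) + 1)) ^ k)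
      (-(1 / (4 : ℝ) ^ k * hurwitzValue k (3 / 4))) := by
    refine h3.neg.congr_fun fun n => ?_
    rw [pow_succ, pow_mul, neg_one_sq, one_pow]; push_cast; ring
  have h := (HasSum.even_add_odd (f := fun n : ℕ => (-1 : ℝ) ^ n / ((2 * (n : ℝ) + 1)) ^ k) he ho).tsum_eq
  rw [betaValue, h]
  field_simp
  ring

/-- The generators of the typed `V_k⁻(4)`: only `a = 1`. [folklore] -/
private theorem oddChowlaMilnorSpace_four (k : ℕ) :
    oddChowlaMilnorSpace k 4 = Submodule.span ℚ {hurwitzOdd k (1 / 4)} := by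
  unfold oddChowlaMilnorSpace
  congr 1
  ext y
  simp only [Set.mem_setOf_eq, Set.mem_singleton_iff]
  constructor
  · rintro ⟨a, ha1, h2a, -, rfl⟩
    obtain rfl : a = 1 := by omega
    norm_num
  · rintro rfl
    exact ⟨1, le_rfl, by norm_num, by norm_num, by norm_num⟩

/-- **`V_k⁻(4) = ℚ·ζ(k)` for odd `k ≥ 3`** (p. 3): the only generator is
`ζ⁻(k,1/4) = ζ(k,1/4) + ζ(k,3/4) = (4^k − 2^k)ζ(k)`. [cite: LaiLi2025, p. 3 (the example q = 4)] -/
theorem oddChowlaMilnorSpace_four_eq_of_odd {k : ℕ} (hk : Odd k) (hk2 : 2 ≤ k) :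
    oddChowlaMilnorSpace k 4 = Submodule.span ℚ {zetaValue k} := by
  rw [oddChowlaMilnorSpace_four]
  have e : hurwitzOdd k (1 / 4) = (((4 : ℚ) ^ k - 2 ^ k) : ℚ) • zetaValue k := by
    rw [hurwitzOdd, Odd.neg_one_pow hk, show (1 : ℝ) - 1 / 4 = 3 / 4 by norm_num, Rat.smul_def]
    push_cast
    linear_combination hurwitzValue_quarter_add hk2
  rw [e]
  refine Submodule.span_singleton_smul_eq (IsUnit.mk0 _ ?_) _
  have : (2 : ℚ) ^ k < 4 ^ k := pow_lt_pow_left₀ (by norm_num) (by norm_num) (by omega)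
  exact (sub_pos.2 this).ne'

/-- **`V_k⁻(4) = ℚ·β(k)` for even `k ≥ 2`** (p. 3): the only generator is `ζ⁻(k,1/4) = ζ(k,1/4) − ζ(k,3/4) = 4^k β(k)`.
[cite: LaiLi2025, p. 3 (the example q = 4)] -/
theorem oddChowlaMilnorSpace_four_eq_of_even {k : ℕ} (hk : Even k) (hk2 : 2 ≤ k) :
    oddChowlaMilnorSpace k 4 = Submodule.span ℚ {betaValue k} := by
  rw [oddChowlaMilnorSpace_four]
  have e : hurwitzOdd k (1 / 4) = (((4 : ℚ) ^ k) : ℚ) • betaValue k := by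
    rw [hurwitzOdd, Even.neg_one_pow hk, one_mul, show (1 : ℝ) - 1 / 4 = 3 / 4 by norm_num, Rat.smul_def,
      hurwitzValue_quarter_sub_eq_betaValue hk2]
    push_cast
    ring
  rw [e]
  exact Submodule.span_singleton_smul_eq (IsUnit.mk0 _ (pow_ne_zero _ (by norm_num))) _

end Literature.NumberTheory.Irrationality.DirichletLValues

end
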